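import Summits.NavierStokesRegularity.NavierStokesRegularity.Theorems.SelfMixingDichotomyCoherentScaleExclusionPassiveScalarL1AntitoneTools
import Literature.Analysis.FluidPDE.PassiveScalarEnergyDecay
import HarnessLib

/-!
# Crux `SelfMixingDichotomy.CoherentScaleExclusion` (stmt-NavierStokesRegularity-1423), line
  `registered`: STUB K `stub_passiveScalarL1Antitone` — Kato's `L¹` contraction for passive scalars

Lands `--supports stmt-NavierStokesRegularity-1423` the registered stub
`stub_passiveScalarL1Antitone` of the lead's skeleton
`Cruxes/CoherentScaleExclusion/Lines/birth.lean` (reshape r2): for a jointly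
smooth, uniformly rapidly decaying scalar `θ` solving `∂ₜθ + ⟪u, ∇θ⟫ = Δθ` on `[a, b] × ℝ³`
(one-sided time derivative within `[a, b]`) in a drift `u` that is, at each time of the slab, `C¹`,
divergence free and square integrable, the `L¹` norm `t ↦ ∫ |θ(t, x)| dx` is nonincreasing on
`[a, b]` — the first ingredient of the drift-independent Nash ceiling of the skeleton.

Proof (Kato's inequality, smooth version; the `ε`-independent tools are in
`SelfMixingDichotomyCoherentScaleExclusionPassiveScalarL1AntitoneTools.lean`). For `ε > 0` let
`φ_ε(s) = √(s² + ε²) − ε`: `C²`, convex, `|φ_ε(s)| ≤ |s|`, `|φ_ε'| ≤ 1`, `0 ≤ φ_ε'' ≤ ε⁻¹`,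
`φ_ε(s) → |s|`.

1. `antitoneOn_integral_comp_of_transport` (for an abstract `C²` function `Φ` with these four
   properties): `F(t) = ∫ Φ(θ(t, x)) dx` is continuous on `[a, b]` and differentiable on `(a, b)`
   with `F' = ∫ Φ'(θ) ∂ₜθ` (differentiation under the integral sign, dominated by the uniform
   decay of `θ` and `∂ₜθ`, as for the `L²` energy in `PassiveScalarEnergyDecay`); by the equation
   `F' = ∫ Φ'(θ) Δθ − ∫ Φ'(θ) ⟪u, ∇θ⟫ = −∑ᵢ ∫ Φ''(θ) (∂ᵢθ)² − ∫ D(Φ ∘ θ)(u) ≤ 0 − 0`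
   (`integral_deriv_comp_mul_laplacian_nonpos`, `integral_fderiv_apply_eq_zero_of_decay_of_memLp`),
   so `F` is antitone (`antitoneOn_of_deriv_nonpos`).
2. `antitoneOn_integral_abs_of_isDivFree_memLp`: `ε = 1/(n+1) → 0` by dominated convergence
   (`|φ_ε(θ)| ≤ |θ|`, integrable by decay):
   `∫ |θ(t)| = lim ∫ φ_ε(θ(t)) ≤ lim ∫ φ_ε(θ(s)) = ∫ |θ(s)|` for `s ≤ t` in `[a, b]`.

The section `General` holds on any finite-dimensional real inner product space; the stub is the
case `EuclideanSpace ℝ (Fin 3)`. References: T. Kato, Israel J. Math. 13 (1972); P. Constantin,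
A. Kiselev, L. Ryzhik, A. Zlatoš, *Diffusion and mixing in fluid flow*, Ann. of Math. 168 (2008),
§1.
-/

noncomputable section

open MeasureTheory Set Function Filter Topology InnerProductSpace
open scoped ContDiff Laplacian InnerProductSpace RealInnerProductSpace

-- `Summit = Problem` for this summit; the tree lakefile sets `weak.linter.dupNamespace = false`.
set_option linter.dupNamespace false

namespace Summit.NavierStokesRegularity.NavierStokesRegularity.Theorems

open Literature.Analysis.FluidPDE

namespace PassiveScalarL1

section General

variable {E : Type*} [NormedAddCommGroup E] [InnerProductSpace ℝ E] [FiniteDimensional ℝ E]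
  [MeasurableSpace E] [BorelSpace E]

/-! ### The regularised `L¹` functional is nonincreasing -/

/-- **Energy method for a convex functional of a passive scalar.** Let `θ` be jointly smooth with
uniform rapid decay on `[a, b] × E`, `a < b`, solving `∂ₜθ + ⟪u, ∇θ⟫ = Δθ` there (one-sided time
derivative within `[a, b]`), in a drift that is `C¹`, divergence free and square integrable at each
time of the slab. Let `Φ : ℝ → ℝ` be `C²` with `|Φ(s)| ≤ |s|`, `|Φ'| ≤ 1`, `0 ≤ Φ'' ≤ M`, `Φ''`
continuous. Then `t ↦ ∫ Φ(θ(t, x)) dx` is nonincreasing on `[a, b]`: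
`d/dt ∫ Φ(θ) = ∫ Φ'(θ) ∂ₜθ = ∫ Φ'(θ) Δθ − ∫ Φ'(θ) ⟪u, ∇θ⟫ = −∫ Φ''(θ) ‖∇θ‖² − 0 ≤ 0`
(differentiation under the integral sign on `(a, b)`, continuity on `[a, b]`,
`integral_deriv_comp_mul_laplacian_nonpos`, `integral_fderiv_apply_eq_zero_of_decay_of_memLp`,
`antitoneOn_of_deriv_nonpos`). -/
theorem antitoneOn_integral_comp_of_transport {a b : ℝ} (hab : a < b)
    {θ : ℝ → E → ℝ} {u : ℝ → E → E}
    (hθ : IsSmoothSpaceTimeOn (Set.Icc a b) θ) (hd : HasUniformRapidDecayOn (Set.Icc a b) θ)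
    (hpde : ∀ t ∈ Set.Icc a b, ∀ x,
      timeDerivWithin (Set.Icc a b) θ t x + ⟪u t x, gradient (θ t) x⟫ = (Δ (θ t)) x)
    (hu1 : ∀ t ∈ Set.Icc a b, ContDiff ℝ 1 (u t))
    (hdiv : ∀ t ∈ Set.Icc a b, VectorCalculus.IsDivFree (u t))
    (hu2 : ∀ t ∈ Set.Icc a b, MemLp (u t) 2 (volume : Measure E))
    {Φ Φ' Φ'' : ℝ → ℝ} {M : ℝ} (hΦ : ∀ s, HasDerivAt Φ (Φ' s) s)
    (hΦ' : ∀ s, HasDerivAt Φ' (Φ'' s) s) (hΦ0 : ∀ s, |Φ s| ≤ |s|) (hΦ'1 : ∀ s, |Φ' s| ≤ 1)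
    (hΦ''0 : ∀ s, 0 ≤ Φ'' s) (hΦ''M : ∀ s, Φ'' s ≤ M) (hΦ''c : Continuous Φ'') :
    AntitoneOn (fun t => ∫ x, Φ (θ t x)) (Set.Icc a b) := by
  set S : Set ℝ := Icc a b with hS_def
  have hS : UniqueDiffOn ℝ S := uniqueDiffOn_Icc hab
  -- decay exponent and uniform decay constants for `θ`, `Dθ`, `D²θ`, `∂ₜθ`
  set K : ℕ := Module.finrank ℝ E + 1 with hK
  have hr1 : (Module.finrank ℝ E : ℝ) < (K : ℝ) := by
    rw [hK]; push_cast; linarith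
  obtain ⟨A0, hA0, hA0b⟩ := hd.norm_le_rpow K
  obtain ⟨A1, hA1, hA1b⟩ := hd.norm_fderiv_le_rpow hθ hS K
  obtain ⟨A2, hA2, hA2b⟩ := hd.norm_fderiv_fderiv_le_rpow hθ hS K
  obtain ⟨A3, hA3, hA3b⟩ := hd.norm_timeDerivWithin_le_rpow hθ hS K
  set C : ℝ := A0 + A1 + A2 + A3 with hC_def
  have hC : 0 ≤ C := by rw [hC_def]; positivity
  have h0 : ∀ s ∈ S, ∀ x, ‖θ s x‖ ≤ C * (1 + ‖x‖) ^ (-(K : ℝ)) := fun s hs x =>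
    le_decay_of_le_decay x (hA0b s hs x) (by rw [hC_def]; linarith)
  have h1 : ∀ s ∈ S, ∀ x, ‖fderiv ℝ (θ s) x‖ ≤ C * (1 + ‖x‖) ^ (-(K : ℝ)) :=
    fun s hs x => le_decay_of_le_decay x (hA1b s hs x) (by rw [hC_def]; linarith)
  have h2 : ∀ s ∈ S, ∀ x, ‖fderiv ℝ (fderiv ℝ (θ s)) x‖ ≤ C * (1 + ‖x‖) ^ (-(K : ℝ)) :=
    fun s hs x => le_decay_of_le_decay x (hA2b s hs x) (by rw [hC_def]; linarith)
  have h3 : ∀ s ∈ S, ∀ x, ‖timeDerivWithin S θ s x‖ ≤ C * (1 + ‖x‖) ^ (-(K : ℝ)) :=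
    fun s hs x => le_decay_of_le_decay x (hA3b s hs x) (by rw [hC_def]; linarith)
  -- regularity of `Φ`
  have hΦc : Continuous Φ := continuous_iff_continuousAt.2 fun s => (hΦ s).continuousAt
  have hΦ'c : Continuous Φ' := continuous_iff_continuousAt.2 fun s => (hΦ' s).continuousAt
  have hΦd : ContDiff ℝ 1 Φ := by
    rw [contDiff_one_iff_deriv]
    refine ⟨fun s => (hΦ s).differentiableAt, ?_⟩
    have hderiv : deriv Φ = Φ' := funext fun s => (hΦ s).deriv
    rw [hderiv]
    exact hΦ'c
  have hΦn : ∀ σ, ‖Φ' σ‖ ≤ 1 := fun σ => by rw [Real.norm_eq_abs]; exact hΦ'1 σ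
  -- the functional and its production
  set e : ℝ → ℝ := fun s => ∫ x, Φ (θ s x) with he_def
  set φ : ℝ → ℝ := fun s => ∫ x, Φ' (θ s x) * timeDerivWithin S θ s x with hφ_def
  -- continuity in `x` at fixed time, in `t` at fixed `x`
  have hθc : ∀ s ∈ S, Continuous (θ s) := fun s hs => hθ.continuous_slice hs
  have hθ'c : ∀ s ∈ S, Continuous (timeDerivWithin S θ s) := fun s hs =>
    hθ.continuous_timeDerivWithin hS hs
  have hθt_c : ∀ x, ContinuousOn (fun s => θ s x) S := fun x => hθ.continuousOn_time x
  have hΔc : ∀ s ∈ S, Continuous (fun x => (Δ (θ s)) x) := fun s hs =>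
    (hθ.laplacian hS).continuous_slice hs
  -- the dominating function
  set bound : E → ℝ := fun x => C * (1 + ‖x‖) ^ (-(K : ℝ)) with hbound_def
  have hbound : Integrable bound (volume : Measure E) := by
    have := (integrable_one_add_norm (E := E) (μ := volume) hr1).const_mul C
    simpa [hbound_def] using this
  have hFle : ∀ s ∈ S, ∀ x, ‖Φ (θ s x)‖ ≤ bound x := by
    intro s hs x
    have h := h0 s hs x
    rw [Real.norm_eq_abs] at h ⊢
    exact (hΦ0 _).trans h
  have hF'le : ∀ s ∈ S, ∀ x, ‖Φ' (θ s x) * timeDerivWithin S θ s x‖ ≤ bound x := by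
    intro s hs x
    rw [norm_mul]
    calc ‖Φ' (θ s x)‖ * ‖timeDerivWithin S θ s x‖ ≤ 1 * (C * (1 + ‖x‖) ^ (-(K : ℝ))) :=
          mul_le_mul (hΦn _) (h3 s hs x) (norm_nonneg _) zero_le_one
      _ = bound x := one_mul _
  have hIe : ∀ s ∈ S, Integrable (fun x => Φ (θ s x)) (volume : Measure E) := fun s hs =>
    Integrable.mono' hbound (hΦc.comp (hθc s hs)).aestronglyMeasurable
      (Eventually.of_forall (hFle s hs))
  -- (B1) the functional is continuous on `[a, b]`
  have hB1 : ContinuousOn e S := by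
    refine continuousOn_of_dominated (bound := bound) (fun s hs => ?_) (fun s hs => ?_) hbound ?_
    · exact (hΦc.comp (hθc s hs)).aestronglyMeasurable
    · exact Eventually.of_forall (hFle s hs)
    · exact Eventually.of_forall fun x => hΦc.comp_continuousOn (hθt_c x)
  -- (B2) the functional is differentiable on `(a, b)` with derivative `φ`
  have hB2 : ∀ s ∈ Ioo a b, HasDerivAt e (φ s) s := by
    intro s hs
    have hsS : s ∈ S := Ioo_subset_Icc_self hs
    have hIoo : Ioo a b ∈ 𝓝 s := Ioo_mem_nhds hs.1 hs.2
    have key := hasDerivAt_integral_of_dominated_loc_of_deriv_le (μ := (volume : Measure E))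
      (F := fun σ x => Φ (θ σ x)) (F' := fun σ x => Φ' (θ σ x) * timeDerivWithin S θ σ x)
      (x₀ := s) (bound := bound) hIoo ?_ (hIe s hsS) ?_ ?_ hbound ?_
    · exact key.2
    · filter_upwards [hIoo] with σ hσ
      exact (hΦc.comp (hθc σ (Ioo_subset_Icc_self hσ))).aestronglyMeasurable
    · exact ((hΦ'c.comp (hθc s hsS)).mul (hθ'c s hsS)).aestronglyMeasurable
    · exact Eventually.of_forall fun x σ hσ => hF'le σ (Ioo_subset_Icc_self hσ) x
    · refine Eventually.of_forall fun x σ hσ => ?_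
      have hσS : σ ∈ S := Ioo_subset_Icc_self hσ
      have hSσ : S ∈ 𝓝 σ := Icc_mem_nhds hσ.1 hσ.2
      have hτ : HasDerivAt (fun τ => θ τ x) (timeDerivWithin S θ σ x) σ :=
        (hθ.hasDerivWithinAt_timeDerivWithin hS hσS x).hasDerivAt hSσ
      exact (hΦ (θ σ x)).comp σ hτ
  -- (B3) the sign of the production: `φ ≤ 0` on `[a, b]`
  have hB3 : ∀ s ∈ S, φ s ≤ 0 := by
    intro s hs
    have hθ1 : ContDiff ℝ 1 (θ s) := contDiff_infty.1 (hθ.contDiff_slice hs) 1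
    have hθ2 : ContDiff ℝ 2 (θ s) := contDiff_infty.1 (hθ.contDiff_slice hs) 2
    -- the equation, solved for the time derivative
    have hpt : ∀ x, timeDerivWithin S θ s x = (Δ (θ s)) x - ⟪u s x, gradient (θ s) x⟫ :=
      fun x => eq_sub_of_add_eq (hpde s hs x)
    -- integrability of `Φ'(θ) Δθ` and `Φ'(θ) ∂ₜθ`, hence of the transport pairing
    have hIΔ : Integrable (fun x => Φ' (θ s x) * (Δ (θ s)) x) (volume : Measure E) := by
      refine integrable_of_norm_le_rpow_neg ((hΦ'c.comp (hθc s hs)).mul (hΔc s hs))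
        (C := Module.finrank ℝ E * C) hr1 fun x => ?_
      rw [norm_mul]
      calc ‖Φ' (θ s x)‖ * ‖(Δ (θ s)) x‖
          ≤ 1 * (Module.finrank ℝ E * ‖fderiv ℝ (fderiv ℝ (θ s)) x‖) :=
            mul_le_mul (hΦn _) (norm_laplacian_le (θ s) x) (norm_nonneg _) zero_le_one
        _ ≤ 1 * (Module.finrank ℝ E * (C * (1 + ‖x‖) ^ (-(K : ℝ)))) := by
            gcongr
            exact h2 s hs x
        _ = Module.finrank ℝ E * C * (1 + ‖x‖) ^ (-(K : ℝ)) := by ring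
    have hIt : Integrable (fun x => Φ' (θ s x) * timeDerivWithin S θ s x) (volume : Measure E) :=
      Integrable.mono' hbound ((hΦ'c.comp (hθc s hs)).mul (hθ'c s hs)).aestronglyMeasurable
        (Eventually.of_forall (hF'le s hs))
    have hfun : (fun x => Φ' (θ s x) * ⟪u s x, gradient (θ s) x⟫) =
        fun x => Φ' (θ s x) * (Δ (θ s)) x - Φ' (θ s x) * timeDerivWithin S θ s x := by
      funext x
      rw [hpt x]
      ring
    have hItr : Integrable (fun x => Φ' (θ s x) * ⟪u s x, gradient (θ s) x⟫)
        (volume : Measure E) := by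
      rw [hfun]
      exact hIΔ.sub' hIt
    -- the transport pairing vanishes: `∫ Φ'(θ) ⟪u, ∇θ⟫ = ∫ D(Φ ∘ θ)(u) = 0`
    have hGd : ∀ y, HasFDerivAt (fun y => Φ (θ s y)) (Φ' (θ s y) • fderiv ℝ (θ s) y) y :=
      fun y => (hΦ (θ s y)).comp_hasFDerivAt y (hθ1.differentiable one_ne_zero y).hasFDerivAt
    have hG0 : ∀ y, ‖Φ (θ s y)‖ ≤ C * (1 + ‖y‖) ^ (-(K : ℝ)) := fun y => hFle s hs y
    have hG1 : ∀ y, ‖fderiv ℝ (fun y => Φ (θ s y)) y‖ ≤ C * (1 + ‖y‖) ^ (-(K : ℝ)) := by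
      intro y
      rw [(hGd y).fderiv, norm_smul]
      calc ‖Φ' (θ s y)‖ * ‖fderiv ℝ (θ s) y‖ ≤ 1 * (C * (1 + ‖y‖) ^ (-(K : ℝ))) :=
            mul_le_mul (hΦn _) (h1 s hs y) (norm_nonneg _) zero_le_one
        _ = _ := one_mul _
    have htr : ∫ x, Φ' (θ s x) * ⟪u s x, gradient (θ s) x⟫ = 0 := by
      have H := integral_fderiv_apply_eq_zero_of_decay_of_memLp (hu1 s hs) (hdiv s hs)
        (hu2 s hs) (hΦd.comp hθ1) hC hr1 hG0 hG1
      rw [← H]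
      refine integral_congr_ae (Eventually.of_forall fun x => ?_)
      show Φ' (θ s x) * ⟪u s x, gradient (θ s) x⟫ = fderiv ℝ (fun y => Φ (θ s y)) x (u s x)
      rw [(hGd x).fderiv, smul_apply, smul_eq_mul, gradient, real_inner_comm, toDual_symm_apply]
    -- the dissipation pairing is nonpositive
    have hlap : ∫ x, Φ' (θ s x) * (Δ (θ s)) x ≤ 0 :=
      integral_deriv_comp_mul_laplacian_nonpos hθ2 hC hr1 (h1 s hs) (h2 s hs) hΦ' hΦ'1 hΦ''0
        hΦ''M hΦ''c
    -- `φ s = ∫ Φ'(θ) Δθ - ∫ Φ'(θ) ⟪u, ∇θ⟫ = ∫ Φ'(θ) Δθ ≤ 0`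
    have hφs : φ s =
        (∫ x, Φ' (θ s x) * (Δ (θ s)) x) - ∫ x, Φ' (θ s x) * ⟪u s x, gradient (θ s) x⟫ := by
      calc φ s = ∫ x, (Φ' (θ s x) * (Δ (θ s)) x - Φ' (θ s x) * ⟪u s x, gradient (θ s) x⟫) := by
            refine integral_congr_ae (Eventually.of_forall fun x => ?_)
            show Φ' (θ s x) * timeDerivWithin S θ s x = _
            rw [hpt x]
            ring
        _ = _ := by rw [integral_sub hIΔ hItr]
    rw [hφs, htr, sub_zero]
    exact hlap
  -- monotonicity from the sign of the derivative
  refine antitoneOn_of_deriv_nonpos (convex_Icc a b) hB1 ?_ ?_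
  · rw [interior_Icc]
    exact fun s hs => (hB2 s hs).differentiableAt.differentiableWithinAt
  · rw [interior_Icc]
    intro s hs
    rw [(hB2 s hs).deriv]
    exact hB3 s (Ioo_subset_Icc_self hs)

/-! ### Kato's `L¹` contraction -/

/-- **The `L¹` norm of a passive scalar is nonincreasing** (Kato's inequality, smooth version).
Let `θ` be jointly smooth with uniform rapid decay on `[a, b] × E`, `a < b`, solving
`∂ₜθ + ⟪u, ∇θ⟫ = Δθ` there (one-sided time derivative within `[a, b]`), where for each
`t ∈ [a, b]` the drift `u t` is `C¹`, divergence free and square integrable (no decay of `u`).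
Then `t ↦ ∫ |θ(t, x)| dx` is nonincreasing on `[a, b]`: apply
`antitoneOn_integral_comp_of_transport` to `φ_ε(s) = √(s² + ε²) − ε`, `ε = 1/(n+1)`, and let
`n → ∞` by dominated convergence (`|φ_ε(θ)| ≤ |θ|`, integrable by decay). -/
theorem antitoneOn_integral_abs_of_isDivFree_memLp {a b : ℝ} (hab : a < b)
    {θ : ℝ → E → ℝ} {u : ℝ → E → E}
    (hθ : IsSmoothSpaceTimeOn (Set.Icc a b) θ) (hd : HasUniformRapidDecayOn (Set.Icc a b) θ)
    (hpde : ∀ t ∈ Set.Icc a b, ∀ x,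
      timeDerivWithin (Set.Icc a b) θ t x + ⟪u t x, gradient (θ t) x⟫ = (Δ (θ t)) x)
    (hu1 : ∀ t ∈ Set.Icc a b, ContDiff ℝ 1 (u t))
    (hdiv : ∀ t ∈ Set.Icc a b, VectorCalculus.IsDivFree (u t))
    (hu2 : ∀ t ∈ Set.Icc a b, MemLp (u t) 2 (volume : Measure E)) :
    AntitoneOn (fun t => ∫ x, |θ t x|) (Set.Icc a b) := by
  -- uniform decay of `θ`, for the domination `|φ_ε(θ)| ≤ |θ| ≤ C (1 + ‖x‖)^{-K}`
  set K : ℕ := Module.finrank ℝ E + 1 with hK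
  have hr1 : (Module.finrank ℝ E : ℝ) < (K : ℝ) := by
    rw [hK]; push_cast; linarith
  obtain ⟨C, hC, hCb⟩ := hd.norm_le_rpow K
  set bound : E → ℝ := fun x => C * (1 + ‖x‖) ^ (-(K : ℝ)) with hbound_def
  have hbound : Integrable bound (volume : Measure E) := by
    have := (integrable_one_add_norm (E := E) (μ := volume) hr1).const_mul C
    simpa [hbound_def] using this
  -- the regularisation parameters `εₙ = 1/(n+1)`
  have hε : ∀ n : ℕ, (0 : ℝ) < 1 / ((n : ℝ) + 1) := fun n => by positivity
  -- each regularised functional is nonincreasing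
  have hanti : ∀ n : ℕ, AntitoneOn
      (fun t => ∫ x, (Real.sqrt ((θ t x) ^ 2 + (1 / ((n : ℝ) + 1)) ^ 2) - 1 / ((n : ℝ) + 1)))
      (Set.Icc a b) := fun n =>
    antitoneOn_integral_comp_of_transport hab hθ hd hpde hu1 hdiv hu2 (hasDerivAt_kato (hε n))
      (hasDerivAt_katoDeriv (hε n)) (abs_kato_le (hε n).le) (abs_katoDeriv_le (hε n))
      (katoDeriv2_nonneg _) (katoDeriv2_le (hε n)) (continuous_katoDeriv2 (hε n))
  -- and converges to the `L¹` norm as `n → ∞`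
  have hlim : ∀ t ∈ Set.Icc a b, Tendsto
      (fun n : ℕ => ∫ x, (Real.sqrt ((θ t x) ^ 2 + (1 / ((n : ℝ) + 1)) ^ 2) - 1 / ((n : ℝ) + 1)))
      atTop (𝓝 (∫ x, |θ t x|)) := by
    intro t ht
    have hθc : Continuous (θ t) := hθ.continuous_slice ht
    refine tendsto_integral_of_dominated_convergence bound (fun n => ?_) hbound
      (fun n => Eventually.of_forall fun x => ?_) (Eventually.of_forall fun x => ?_)
    · exact Continuous.aestronglyMeasurable (by fun_prop)
    · have h := hCb t ht x
      rw [Real.norm_eq_abs] at h ⊢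
      exact (abs_kato_le (hε n).le _).trans h
    · exact tendsto_kato_abs (θ t x)
  intro s hs t ht hst
  exact le_of_tendsto_of_tendsto' (hlim t ht) (hlim s hs) fun n => hanti n hs ht hst

end General

end PassiveScalarL1

/-- **stub K — `stub_passiveScalarL1Antitone`: the `L¹` norm of a passive scalar is
nonincreasing** (registered stub of `Cruxes/CoherentScaleExclusion/Lines/birth.lean`, reshape r2).
Let `θ` be jointly smooth with uniform rapid decay on `[a, b] × ℝ³`, `a < b`, solving
`∂ₜθ + ⟪u, ∇θ⟫ = Δθ` there (one-sided time derivative within `[a, b]`), where at each time of the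
slab the drift `u t` is `C¹`, divergence free and square integrable (NO decay of `u`). Then
`t ↦ ∫ |θ(t)|` is nonincreasing on `[a, b]` (Kato's inequality:
`PassiveScalarL1.antitoneOn_integral_abs_of_isDivFree_memLp` on `EuclideanSpace ℝ (Fin 3)`). -/
theorem stub_passiveScalarL1Antitone :
    ∀ (a b : ℝ), a < b →
      ∀ (u : ℝ → EuclideanSpace ℝ (Fin 3) → EuclideanSpace ℝ (Fin 3))
        (θ : ℝ → EuclideanSpace ℝ (Fin 3) → ℝ),
      Literature.Analysis.FluidPDE.IsSmoothSpaceTimeOn (Set.Icc a b) θ →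
      Literature.Analysis.FluidPDE.HasUniformRapidDecayOn (Set.Icc a b) θ →
      (∀ t ∈ Set.Icc a b, ∀ x : EuclideanSpace ℝ (Fin 3),
        Literature.Analysis.FluidPDE.timeDerivWithin (Set.Icc a b) θ t x +
            inner ℝ (u t x) (gradient (θ t) x) =
          Laplacian.laplacian (θ t) x) →
      (∀ t ∈ Set.Icc a b, ContDiff ℝ 1 (u t)) →
      (∀ t ∈ Set.Icc a b, Literature.Analysis.FluidPDE.VectorCalculus.IsDivFree (u t)) →
      (∀ t ∈ Set.Icc a b, MeasureTheory.MemLp (u t) 2 MeasureTheory.volume) →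
      AntitoneOn (fun t => ∫ x, |θ t x|) (Set.Icc a b) := by
  intro a b hab u θ hθ hd hpde hu1 hdiv hu2
  exact PassiveScalarL1.antitoneOn_integral_abs_of_isDivFree_memLp hab hθ hd hpde hu1 hdiv hu2

end Summit.NavierStokesRegularity.NavierStokesRegularity.Theorems
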